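import Literature.Probability.RandomPlanarGeometry.SAWStripTMInv
import HarnessLib

/-!
# The invariant of the enriched strip transfer matrix, II: `advance` preserves it (soundness, part 6)

Topic `Literature/Probability/RandomPlanarGeometry` (soundness of `SAWStripTM.lean`, part 6;
continues `SAWStripTMInv.lean`). Shared bookkeeping lemmas for a micro-step and the proof that
the vertical micro-step `advance` (executable) / `gAdvance` (ghost) preserves `Inv`.

## References

* I. Jensen, J. Phys. A 37 (2004) 11521–11529, §2.1.
* D. E. Knuth, TAOCP 4A (2011), §7.1.4.
-/

namespace Literature.Probability.RandomPlanarGeometry.SAW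

namespace StripTM

variable {l r0 : ℕ}

/-! ### Small bookkeeping lemmas -/

/-- `isStart t` iff `t` is the cell-time of the start cell. [folklore] -/
theorem isStart_iff {t : ℕ} (hl : 0 < l) : isStart l r0 t = true ↔ t = r0 * l := by
  rw [isStart, decide_eq_true_eq]
  constructor
  · rintro ⟨h1, h2⟩; have := Nat.div_add_mod t l; rw [h1, h2, Nat.add_zero, Nat.mul_comm] at this
    exact this.symm
  · rintro rfl; exact ⟨Nat.mul_mod_left _ _, Nat.mul_div_cancel _ hl⟩

/-- The start cell. [folklore] -/
theorem cellOf_start (hl : 0 < l) : cellOf l (r0 * l) = .cell 0 (r0 + 1) := by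
  simp [cellOf, Nat.mul_mod_left, Nat.mul_div_cancel _ hl]

/-- `cellOf t` is the start cell iff `isStart t`. [folklore] -/
theorem cellOf_eq_start_iff {t : ℕ} (hl : 0 < l) : cellOf l t = .cell 0 (r0 + 1) ↔ isStart l r0 t = true := by
  rw [isStart_iff hl]
  constructor
  · intro h
    simp only [cellOf, XCell.cell.injEq] at h
    have h2 : t / l = r0 := by omega
    have := Nat.div_add_mod t l; rw [h.1, h2, Nat.add_zero, Nat.mul_comm] at this
    exact this.symm
  · rintro rfl; exact cellOf_start hl

/-- `hcount` does not change at an even micro-step. [folklore] -/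
theorem hcount_succ_of_even {cs : List Bool} {u : ℕ} (hu : u % 2 = 0) (c : ℕ) :
    hcount l cs (u + 1) c = hcount l cs u c := by
  rw [hcount, hcount, List.range_succ, List.filter_append, List.length_append]
  simp [hu]

/-- `hcount` at an odd micro-step. [folklore] -/
theorem hcount_succ_of_odd {cs : List Bool} {u : ℕ} (hu : u % 2 = 1) (c : ℕ) :
    hcount l cs (u + 1) c = hcount l cs u c + if u / 2 % l = c ∧ cs.getD u false = true then 1 else 0 := by
  rw [hcount, hcount, List.range_succ, List.filter_append, List.length_append, List.filter_singleton]
  by_cases h : u / 2 % l = c ∧ cs.getD u false = true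
  · rw [if_pos h, decide_eq_true ⟨hu, h⟩]; rfl
  · rw [if_neg h, decide_eq_false (fun h' => h h'.2)]; rfl

/-- `potEdge` at an even micro-step. [folklore] -/
theorem potEdge_of_even {u : ℕ} (hu : u % 2 = 0) : potEdge l u = s(below l (u / 2), cellOf l (u / 2)) := by
  rw [potEdge, if_pos hu]

/-- `potEdge` at an odd micro-step. [folklore] -/
theorem potEdge_of_odd {u : ℕ} (hu : u % 2 = 1) : potEdge l u = s(leftOf l (u / 2), cellOf l (u / 2)) := by
  rw [potEdge, if_neg (by omega)]

/-- The vertical edge of the current cell. [folklore] -/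
theorem adj_below_cellOf (t : ℕ) : Adj l r0 (below l t) (cellOf l t) := by
  simp [Adj, below, cellOf]

/-- The cell below is not the current cell. [folklore] -/
theorem below_ne_cellOf (t : ℕ) : below l t ≠ cellOf l t := by
  simp [below, cellOf]

/-- The start cell is adjacent to the virtual source. [folklore] -/
theorem adj_cellOf_vsrc {t : ℕ} (hl : 0 < l) (h : isStart l r0 t = true) : Adj l r0 (cellOf l t) .vsrc := by
  rw [(cellOf_eq_start_iff hl).2 h]; simp [Adj]

/-- A cell of the last column is adjacent to the virtual sink. [folklore] -/
theorem adj_below_vsnk {t : ℕ} (h : t % l + 1 = l) : Adj l r0 (below l t) .vsnk := by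
  simp [Adj, below, h]

/-- At an even micro-step at a `stop`/`empty`... the cell below the current cell, if in the family
or coded `empty`/`stop`, is swept when its row is positive. [folklore] -/
theorem processed_below {u : ℕ} (hu : u % 2 = 0) (hl : 0 < l) (hr : 1 ≤ u / 2 / l) :
    Processed l u (below l (u / 2)) := by
  refine ⟨hr, Nat.mod_lt _ hl, ?_⟩
  have := Nat.div_add_mod (u / 2) l
  have h2 : (u / 2 / l - 1) * l + u / 2 % l + l = u / 2 := by
    rw [Nat.mul_comm]
    have : l * (u / 2 / l - 1) + l = l * (u / 2 / l) := by
      rw [← Nat.mul_succ]; congr 1; omega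
    omega
  omega

/-- The source time versus `isStart`, at an even micro-step that is not the start. [folklore] -/
theorem src_time_succ_iff {u : ℕ} (hu : u % 2 = 0) (hl : 0 < l) (hst : isStart l r0 (u / 2) = false) :
    2 * (r0 * l) + 1 ≤ u + 1 ↔ 2 * (r0 * l) + 1 ≤ u := by
  constructor
  · intro h
    rcases Nat.lt_or_ge (r0 * l) (u / 2) with h1 | h1
    · omega
    · have : u / 2 = r0 * l := by omega
      rw [← isStart_iff (r0 := r0) hl] at this; rw [this] at hst; exact absurd hst (by simp)
  · omega

/-- The source time at the start. [folklore] -/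
theorem src_time_of_start {u : ℕ} (hu : u % 2 = 0) (hl : 0 < l) (hst : isStart l r0 (u / 2) = true) :
    2 * (r0 * l) + 1 ≤ u + 1 ∧ ¬ 2 * (r0 * l) + 1 ≤ u := by
  rw [isStart_iff hl] at hst; omega

/-! ### `advance` preserves the invariant -/

section Advance

variable {cs : List Bool} {u : ℕ} {σ σ' : State} {S : List (List XCell)}

/-- Frame lemma: at an `advance` the mates of untouched columns keep their meaning provided no
code points to the current column. [folklore] -/
theorem mateCell_succ_of {u : ℕ} (hu : u % 2 = 0) {m : Mate} (h : ∀ j, m = .col j → j ≠ u / 2 % l) :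
    mateCell l (u + 1) m = mateCell l u m := by
  cases m with
  | col j => exact front_succ_of_ne hu (h j rfl)
  | src => rfl
  | snk => rfl

/-- **Case `empty`/edge of `advance`.** [cite: Jensen2004SAWLowerBounds, §2.1] -/
theorem inv_advance_empty_true (hl : 2 ≤ l) (hu : u % 2 = 0) (hI : Inv l r0 cs u σ S)
    (hcode : σ.slots[u / 2 % l]? = some Code.empty) (hcs : cs.getD u false = true)
    (he : advance l r0 (u / 2) σ true = .next σ') :
    Inv l r0 cs (u + 1) σ' (gAdvance l r0 (u / 2) σ S true) := by
  have hl0 : 0 < l := by omega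
  have hc : u / 2 % l < l := Nat.mod_lt _ hl0
  have hcs' : u / 2 % l < σ.slots.length := by rw [hI.len_slots]; exact hc
  rw [advance_empty_true l r0 hcode] at he
  split_ifs at he with hcond
  obtain ⟨hcl, hsink, hst⟩ := hcond
  have hsl : σ'.slots = σ.slots.set (u / 2 % l) (.stop .snk) := by cases he; rfl
  have hga : σ'.gaps = σ.gaps := by cases he; rfl
  have hsi : σ'.sink = true := by cases he; rfl
  rw [gAdvance_empty_true l r0 S hcode]
  -- the family
  have hdf : below l (u / 2) = front l u (u / 2 % l) := below_eq_front hu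
  have hdnot : below l (u / 2) ∉ cells S := hdf ▸ hI.empty _ hc hcode
  have hvnot : cellOf l (u / 2) ∉ cells S := fun h => not_processed_cellOf hu hl0 (hI.processed _ h)
  have hA := adj_symm l r0
  obtain ⟨hW2, h2le2, hcells2, hpairs2, hends2⟩ :=
    new2_spec hI.wf hA hI.two_le hdnot hvnot (below_ne_cellOf (u / 2)) (adj_below_cellOf (u / 2))
  have hvsnk : XCell.vsnk ∉ cells (merge (S ++ [[below l (u / 2)]] ++ [[cellOf l (u / 2)]])
      (below l (u / 2)) (cellOf l (u / 2))) := by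
    rw [hcells2]; simp only [Finset.mem_insert, below, cellOf, false_or, reduceCtorEq]
    rw [hI.vsnk_mem, hsink]; simp
  have hdb : (below l (u / 2), cellOf l (u / 2)) ∈ endPairs (merge (S ++ [[below l (u / 2)]] ++
      [[cellOf l (u / 2)]]) (below l (u / 2)) (cellOf l (u / 2))) :=
    (hends2 _ _).2 (Or.inr (Or.inl ⟨rfl, rfl⟩))
  obtain ⟨hW3, h2le3, hcells3, hpairs3, hends3⟩ :=
    extend_spec hW2 hA h2le2 hdb (by simp [below, XCell.IsReal]) hvsnk (adj_below_vsnk hcl)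
  -- the row of the cell below is positive
  have hr : 1 ≤ u / 2 / l := by
    by_contra h0
    have h00 : u / 2 / l = 0 := Nat.eq_zero_of_not_pos h0
    have : front l u (u / 2 % l) = .cell (u / 2 % l) 0 := by rw [← hdf, below, h00]
    have := hI.dummy _ hc _ this
    rw [hcode] at this; exact absurd this (by simp)
  -- no code points to the current column
  have hnoc : ∀ k < l, ∀ m, σ.slots[k]? = some (Code.stop m) → ∀ j, m = Mate.col j → j ≠ u / 2 % l := by
    intro k hk m hkm j hj e; subst hj; subst e
    exact hI.no_mate_of_not_mem (hdf ▸ hdnot) hk hkm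
  refine ⟨?_, ?_, ?_, hW3, h2le3, ?_, ?_, ?_, ?_, ?_, ?_, ?_, ?_⟩
  · rw [hsl, List.length_set, hI.len_slots]
  · rw [hga, hI.len_gaps]
  · intro k j h
    rw [hsl, List.getElem?_set] at h
    split_ifs at h with h1
    · simp at h
    · exact hI.mate_lt k j h
  · -- processed
    intro x hx
    rw [hcells3, hcells2] at hx
    simp only [Finset.mem_insert] at hx
    rcases hx with rfl | rfl | rfl | hx
    · trivial
    · exact (processed_succ_even hu hl0 _).2 (Or.inl (processed_below hu hl0 hr))
    · exact (processed_succ_even hu hl0 _).2 (Or.inr rfl)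
    · exact (processed_succ_even hu hl0 _).2 (Or.inl (hI.processed x hx))
  · -- ends
    intro a b ha
    rw [hends3, hsl]
    simp only [hends2]
    constructor
    · rintro ((⟨hab | ⟨rfl, rfl⟩ | ⟨rfl, rfl⟩, hne1, hne2⟩) | ⟨rfl, rfl⟩ | ⟨rfl, rfl⟩)
      · -- an old end pair
        obtain ⟨k, hk, m, hkm, rfl, rfl⟩ := (hI.ends a b ha).1 hab
        have hkc : k ≠ u / 2 % l := by rintro rfl; rw [hcode] at hkm; simp at hkm
        refine ⟨k, hk, m, ?_, (front_succ_of_ne hu hkc).symm, (mateCell_succ_of hu (hnoc k hk m hkm)).symm⟩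
        rw [List.getElem?_set_ne (Ne.symm hkc)]; exact hkm
      · exact absurd rfl hne1
      · exact absurd rfl hne2
      · exact ⟨u / 2 % l, hc, .snk, by rw [List.getElem?_set_self hcs'], cellOf_eq_front_succ hu, rfl⟩
      · exact absurd ha (by simp [XCell.IsReal])
    · rintro ⟨k, hk, m, hkm, rfl, rfl⟩
      rw [List.getElem?_set] at hkm
      split_ifs at hkm with h1
      · -- the new code of the current column
        subst h1; cases hkm
        exact Or.inr (Or.inl ⟨(cellOf_eq_front_succ hu).symm, rfl⟩)
      · have hkc : k ≠ u / 2 % l := Ne.symm h1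
        have ha' : (front l u k).IsReal := by rw [front_succ_of_ne hu hkc] at ha; exact ha
        refine Or.inl ⟨Or.inl ?_, ?_, ?_⟩
        · rw [front_succ_of_ne hu hkc, mateCell_succ_of hu (hnoc k hk m hkm)]
          exact (hI.ends _ _ ha').2 ⟨k, hk, m, hkm, rfl, rfl⟩
        · rw [front_succ_of_ne hu hkc, hdf]; intro e; exact hkc (front_inj e)
        · rw [front_succ_of_ne hu hkc]
          obtain ⟨r', hr'⟩ := front_eq_cell (l := l) u k
          rw [hr', cellOf]; intro e; cases e; exact hkc rfl
  · -- empty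
    intro k hk hk'
    rw [hsl, List.getElem?_set] at hk'
    split_ifs at hk' with h1
    · simp at hk'
    · have hkc : k ≠ u / 2 % l := Ne.symm h1
      rw [front_succ_of_ne hu hkc, hcells3, hcells2]
      simp only [Finset.mem_insert, not_or]
      obtain ⟨r', hr'⟩ := front_eq_cell (l := l) u k
      refine ⟨by rw [hr']; simp, ?_, ?_, hI.empty k hk hk'⟩
      · rw [hdf]; intro e; exact hkc (front_inj e)
      · rw [hr', cellOf]; intro e; cases e; exact hkc rfl
  · -- dummy
    intro k hk c' hk'
    rw [hsl, List.getElem?_set]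
    split_ifs with h1
    · exfalso; subst h1
      rw [← cellOf_eq_front_succ hu, cellOf] at hk'; cases hk'
    · rw [front_succ_of_ne hu (Ne.symm h1)] at hk'
      exact hI.dummy k hk c' hk'
  · -- vsrc
    rw [hcells3, hcells2]
    simp only [Finset.mem_insert, below, cellOf, reduceCtorEq, false_or]
    rw [hI.vsrc_mem, src_time_succ_iff hu hl0 hst]
  · -- vsnk
    rw [hcells3, hsi]; simp
  · -- pairs
    intro p
    rw [hpairs3, hpairs2, Nat.exists_lt_succ_right, potEdge_of_even hu, hcs]
    simp only [Finset.mem_insert, true_and]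
    constructor
    · rintro ⟨rfl | rfl | hp, hreal⟩
      · exact absurd (Sym2.ball.1 hreal).2 (by simp [XCell.IsReal])
      · exact Or.inr rfl
      · exact Or.inl ((hI.pairs_iff p).1 ⟨hp, hreal⟩)
    · rintro (h | rfl)
      · obtain ⟨hp, hreal⟩ := (hI.pairs_iff p).2 h
        exact ⟨Or.inr (Or.inr hp), hreal⟩
      · refine ⟨Or.inr (Or.inl rfl), ?_⟩
        rw [Sym2.ball]; simp [below, cellOf, XCell.IsReal]
  · -- gaps
    intro k hk
    rw [hga, hcount_succ_of_even hu]
    exact hI.gaps_eq k hk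

/-- Under the invariant, the far end of the `stop`-coded cell below is coded: if
`(a, below) ∈ endPairs S` with `a` real then `a = front u k'` with code `stop (col c)`. [folklore] -/
theorem Inv.far_end_code (hI : Inv l r0 cs u σ S) (hu : u % 2 = 0) {a : XCell} (ha : a.IsReal)
    (h : (a, below l (u / 2)) ∈ endPairs S) :
    ∃ k' < l, σ.slots[k']? = some (Code.stop (.col (u / 2 % l))) ∧ a = front l u k' := by
  obtain ⟨k', hk', m', hkm', rfl, hb⟩ := (hI.ends a _ ha).1 h
  refine ⟨k', hk', ?_, rfl⟩
  cases m' with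
  | col j =>
    simp only [mateCell] at hb
    rw [below_eq_front hu] at hb
    rw [hkm', front_inj hb]
  | src => simp [mateCell, below] at hb
  | snk => simp [mateCell, below] at hb

/-- Under the invariant, `mateCell u m' = below` forces `m' = col c`. [folklore] -/
theorem mateCell_eq_below_iff {u : ℕ} (hu : u % 2 = 0) {m' : Mate} :
    mateCell l u m' = below l (u / 2) ↔ m' = .col (u / 2 % l) := by
  constructor
  · intro h
    cases m' with
    | col j => simp only [mateCell] at h; rw [below_eq_front hu] at h; rw [front_inj h]
    | src => simp [mateCell, below] at h
    | snk => simp [mateCell, below] at h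
  · rintro rfl; simp only [mateCell]; rw [below_eq_front hu]

/-- **Case `stop`/edge of `advance`, not at the start cell**: the strand ending below is
extended by the current cell. [cite: Jensen2004SAWLowerBounds, §2.1] -/
theorem inv_advance_stop_true (hl : 2 ≤ l) (hu : u % 2 = 0) (hI : Inv l r0 cs u σ S) {m : Mate}
    (hcode : σ.slots[u / 2 % l]? = some (Code.stop m)) (hst : isStart l r0 (u / 2) = false)
    (hcs : cs.getD u false = true) (he : advance l r0 (u / 2) σ true = .next σ') :
    Inv l r0 cs (u + 1) σ' (gAdvance l r0 (u / 2) σ S true) := by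
  have hl0 : 0 < l := by omega
  have hc : u / 2 % l < l := Nat.mod_lt _ hl0
  rw [advance_stop_true l r0 hcode hst] at he
  cases he
  rw [gAdvance_stop_true l r0 S hcode, if_neg (by rw [hst]; exact Bool.false_ne_true)]
  -- the family
  have hdf : below l (u / 2) = front l u (u / 2 % l) := below_eq_front hu
  have hvnot : cellOf l (u / 2) ∉ cells S := fun h => not_processed_cellOf hu hl0 (hI.processed _ h)
  have hA := adj_symm l r0
  have hdreal : (below l (u / 2)).IsReal := by simp [below, XCell.IsReal]
  have hdb : (below l (u / 2), mateCell l u m) ∈ endPairs S :=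
    (hI.ends _ _ hdreal).2 ⟨_, hc, m, hcode, hdf, rfl⟩
  obtain ⟨hW2, h2le2, hcells2, hpairs2, hends2⟩ :=
    extend_spec hI.wf hA hI.two_le hdb hdreal hvnot (adj_below_cellOf (u / 2))
  have hbd_ne : mateCell l u m ≠ below l (u / 2) := (ne_of_mem_endPairs' hI.wf hI.two_le hdb).symm
  have hm_ne : ∀ j, m = .col j → j ≠ u / 2 % l := by
    intro j hj e; subst hj; subst e; exact hbd_ne ((mateCell_eq_below_iff hu).2 rfl)
  -- uniqueness of the far end of `below`
  have hfar : ∀ a, (a, below l (u / 2)) ∈ endPairs S → a = mateCell l u m := fun a h =>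
    hI.wf.endPairs_unique (endPairs_symm h) hdb
  refine ⟨hI.len_slots, hI.len_gaps, hI.mate_lt, hW2, h2le2, ?_, ?_, ?_, ?_, ?_, ?_, ?_, ?_⟩
  · intro x hx
    rw [hcells2, Finset.mem_insert] at hx
    rcases hx with rfl | hx
    · exact (processed_succ_even hu hl0 _).2 (Or.inr rfl)
    · exact (processed_succ_even hu hl0 _).2 (Or.inl (hI.processed x hx))
  · -- ends
    intro a b ha
    rw [hends2]
    constructor
    · rintro (⟨hab, hne1, hne2⟩ | ⟨rfl, rfl⟩ | ⟨rfl, rfl⟩)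
      · obtain ⟨k, hk, m', hkm, rfl, rfl⟩ := (hI.ends a b ha).1 hab
        have hkc : k ≠ u / 2 % l := by rintro rfl; exact hne1 hdf.symm
        have hm' : ∀ j, m' = .col j → j ≠ u / 2 % l := by
          intro j hj e; subst hj; subst e
          apply hne2; apply hfar
          simpa only [mateCell, ← hdf] using hab
        exact ⟨k, hk, m', hkm, (front_succ_of_ne hu hkc).symm, (mateCell_succ_of hu hm').symm⟩
      · -- (far end, current cell)
        obtain ⟨k', hk', hkm', hak'⟩ := hI.far_end_code hu ha (endPairs_symm hdb)
        have hkc : k' ≠ u / 2 % l := by rintro rfl; rw [← hdf] at hak'; exact hbd_ne hak'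
        refine ⟨k', hk', _, hkm', by rw [front_succ_of_ne hu hkc]; exact hak', ?_⟩
        simp only [mateCell]; exact cellOf_eq_front_succ hu
      · refine ⟨_, hc, m, hcode, cellOf_eq_front_succ hu, (mateCell_succ_of hu hm_ne).symm⟩
    · rintro ⟨k, hk, m', hkm, rfl, rfl⟩
      by_cases hkc : k = u / 2 % l
      · subst hkc
        rw [hcode] at hkm; cases hkm
        exact Or.inr (Or.inr ⟨(cellOf_eq_front_succ hu).symm, mateCell_succ_of hu hm_ne⟩)
      · rw [front_succ_of_ne hu hkc]
        have hold := (hI.ends _ _ (by rw [front_succ_of_ne hu hkc] at ha; exact ha)).2 ⟨k, hk, m', hkm, rfl, rfl⟩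
        by_cases hmc : m' = .col (u / 2 % l)
        · subst hmc
          right; left
          refine ⟨hfar _ (by simpa only [mateCell, ← hdf] using hold), ?_⟩
          simp only [mateCell]; exact (cellOf_eq_front_succ hu).symm
        · have hm' : ∀ j, m' = .col j → j ≠ u / 2 % l := by intro j hj e; subst hj; subst e; exact hmc rfl
          rw [mateCell_succ_of hu hm']
          refine Or.inl ⟨hold, ?_, ?_⟩
          · rw [hdf]; intro e; exact hkc (front_inj e)
          · intro e
            have h1 : (mateCell l u m, mateCell l u m') ∈ endPairs S := e ▸ hold
            have h2 := hI.wf.endPairs_unique h1 (endPairs_symm hdb)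
            exact hmc ((mateCell_eq_below_iff hu).1 h2)
  · -- empty
    intro k hk hk'
    have hkc : k ≠ u / 2 % l := by rintro rfl; rw [hcode] at hk'; simp at hk'
    rw [front_succ_of_ne hu hkc, hcells2, Finset.mem_insert, not_or]
    obtain ⟨r', hr'⟩ := front_eq_cell (l := l) u k
    exact ⟨by rw [hr', cellOf]; intro e; cases e; exact hkc rfl, hI.empty k hk hk'⟩
  · -- dummy
    intro k hk c' hk'
    by_cases hkc : k = u / 2 % l
    · exfalso; subst hkc; rw [← cellOf_eq_front_succ hu, cellOf] at hk'; cases hk'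
    · rw [front_succ_of_ne hu hkc] at hk'; exact hI.dummy k hk c' hk'
  · rw [hcells2, Finset.mem_insert, hI.vsrc_mem, src_time_succ_iff hu hl0 hst]; simp [cellOf]
  · rw [hcells2, Finset.mem_insert, hI.vsnk_mem]; simp [cellOf]
  · intro p
    rw [hpairs2, Nat.exists_lt_succ_right, potEdge_of_even hu, hcs, Finset.mem_insert]
    simp only [true_and]
    constructor
    · rintro ⟨rfl | hp, hreal⟩
      · exact Or.inr rfl
      · exact Or.inl ((hI.pairs_iff p).1 ⟨hp, hreal⟩)
    · rintro (h | rfl)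
      · obtain ⟨hp, hreal⟩ := (hI.pairs_iff p).2 h; exact ⟨Or.inr hp, hreal⟩
      · exact ⟨Or.inl rfl, Sym2.ball.2 ⟨by simp [below, XCell.IsReal], by simp [cellOf, XCell.IsReal]⟩⟩
  · intro k hk; rw [hcount_succ_of_even hu]; exact hI.gaps_eq k hk

/-- Under the invariant, no code points to a column whose frontier cell is not a strand end.
[folklore] -/
theorem Inv.no_col_of_not_stop (hI : Inv l r0 cs u σ S) {c : ℕ} (hc : c < l)
    (hns : ∀ m, σ.slots[c]? ≠ some (Code.stop m)) {k' : ℕ} (hk' : k' < l) {m' : Mate}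
    (hkm' : σ.slots[k']? = some (Code.stop m')) : ∀ j, m' = .col j → j ≠ c := by
  intro j hj e; subst hj; subst e
  obtain ⟨r, hr⟩ := front_eq_cell (l := l) u k'
  have h1 : (front l u k', front l u j) ∈ endPairs S :=
    (hI.ends _ _ (by rw [hr]; trivial)).2 ⟨k', hk', _, hkm', rfl, rfl⟩
  obtain ⟨r', hr'⟩ := front_eq_cell (l := l) u j
  obtain ⟨k'', -, m'', hkm'', hf, -⟩ := (hI.ends _ _ (by rw [hr']; trivial)).1 (endPairs_symm h1)
  rw [front_inj hf] at hns
  exact hns m'' hkm''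

/-- **Case no edge of `advance` with the cell below unused or closed.** [cite: Jensen2004SAWLowerBounds, §2.1] -/
theorem inv_advance_noedge (hl : 2 ≤ l) (hu : u % 2 = 0) (hI : Inv l r0 cs u σ S)
    (hcode : σ.slots[u / 2 % l]? = some Code.empty ∨ σ.slots[u / 2 % l]? = some Code.inter)
    (hcs : cs.getD u false = false) (he : advance l r0 (u / 2) σ false = .next σ') :
    Inv l r0 cs (u + 1) σ' (gAdvance l r0 (u / 2) σ S false) := by
  have hl0 : 0 < l := by omega
  have hc : u / 2 % l < l := Nat.mod_lt _ hl0
  have hcs' : u / 2 % l < σ.slots.length := by rw [hI.len_slots]; exact hc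
  -- unfold both automata
  have he' : σ' = { σ with slots := σ.slots.set (u / 2 % l) (if isStart l r0 (u / 2) then .stop .src else .empty) } := by
    rcases hcode with h | h
    · rw [advance_empty_false l r0 h] at he; cases he; rfl
    · rw [advance_inter_false l r0 h] at he; cases he; rfl
  have hg : gAdvance l r0 (u / 2) σ S false = if isStart l r0 (u / 2) then
      merge (S ++ [[cellOf l (u / 2)]] ++ [[.vsrc]]) (cellOf l (u / 2)) .vsrc else S := by
    rcases hcode with h | h
    · exact gAdvance_empty_false l r0 S h
    · exact gAdvance_inter_false l r0 S h
  have hsl : σ'.slots = σ.slots.set (u / 2 % l) (if isStart l r0 (u / 2) then .stop .src else .empty) := by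
    rw [he']
  have hga : σ'.gaps = σ.gaps := by rw [he']
  have hsi : σ'.sink = σ.sink := by rw [he']
  rw [hg]
  have hns : ∀ m, σ.slots[u / 2 % l]? ≠ some (Code.stop m) := by
    intro m h; rcases hcode with h' | h' <;> rw [h'] at h <;> simp at h
  have hnoc : ∀ k' < l, ∀ m', σ.slots[k']? = some (Code.stop m') → ∀ j, m' = .col j → j ≠ u / 2 % l :=
    fun k' hk' m' hkm' => hI.no_col_of_not_stop hc hns hk' hkm'
  have hvnot : cellOf l (u / 2) ∉ cells S := fun h => not_processed_cellOf hu hl0 (hI.processed _ h)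
  have hA := adj_symm l r0
  -- common part of `ends`: the old end pairs, reindexed
  have hends_old : ∀ a b, a.IsReal → ((a, b) ∈ endPairs S ↔
      ∃ k < l, ∃ m, k ≠ u / 2 % l ∧ σ.slots[k]? = some (Code.stop m) ∧ a = front l (u + 1) k ∧
        b = mateCell l (u + 1) m) := by
    intro a b ha
    rw [hI.ends a b ha]
    constructor
    · rintro ⟨k, hk, m, hkm, rfl, rfl⟩
      have hkc : k ≠ u / 2 % l := by rintro rfl; exact hns m hkm
      exact ⟨k, hk, m, hkc, hkm, (front_succ_of_ne hu hkc).symm, (mateCell_succ_of hu (hnoc k hk m hkm)).symm⟩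
    · rintro ⟨k, hk, m, hkc, hkm, rfl, rfl⟩
      exact ⟨k, hk, m, hkm, front_succ_of_ne hu hkc, mateCell_succ_of hu (hnoc k hk m hkm)⟩
  by_cases hst : isStart l r0 (u / 2) = true
  · -- at the start cell: the source is attached to the current cell
    rw [if_pos hst]
    simp only [hst, if_true] at hsl
    have hvsrc : XCell.vsrc ∉ cells S := by rw [hI.vsrc_mem]; exact (src_time_of_start hu hl0 hst).2
    obtain ⟨hW2, h2le2, hcells2, hpairs2, hends2⟩ :=
      new2_spec hI.wf hA hI.two_le hvnot hvsrc (by simp [cellOf]) (adj_cellOf_vsrc hl0 hst)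
    refine ⟨?_, ?_, ?_, hW2, h2le2, ?_, ?_, ?_, ?_, ?_, ?_, ?_, ?_⟩
    · rw [hsl, List.length_set, hI.len_slots]
    · rw [hga, hI.len_gaps]
    · intro k j h
      rw [hsl, List.getElem?_set] at h
      split_ifs at h with h1
      · simp at h
      · exact hI.mate_lt k j h
    · intro x hx
      rw [hcells2] at hx; simp only [Finset.mem_insert] at hx
      rcases hx with rfl | rfl | hx
      · exact (processed_succ_even hu hl0 _).2 (Or.inr rfl)
      · trivial
      · exact (processed_succ_even hu hl0 _).2 (Or.inl (hI.processed x hx))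
    · intro a b ha
      rw [hends2, hends_old a b ha, hsl]
      constructor
      · rintro (⟨k, hk, m, hkc, hkm, rfl, rfl⟩ | ⟨rfl, rfl⟩ | ⟨rfl, rfl⟩)
        · exact ⟨k, hk, m, by rw [List.getElem?_set_ne (Ne.symm hkc)]; exact hkm, rfl, rfl⟩
        · exact ⟨_, hc, .src, by rw [List.getElem?_set_self hcs'], cellOf_eq_front_succ hu, rfl⟩
        · exact absurd ha (by simp [XCell.IsReal])
      · rintro ⟨k, hk, m, hkm, rfl, rfl⟩
        rw [List.getElem?_set] at hkm
        split_ifs at hkm with h1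
        · subst h1; cases hkm
          exact Or.inr (Or.inl ⟨(cellOf_eq_front_succ hu).symm, rfl⟩)
        · exact Or.inl ⟨k, hk, m, Ne.symm h1, hkm, rfl, rfl⟩
    · intro k hk hk'
      rw [hsl, List.getElem?_set] at hk'
      split_ifs at hk' with h1
      · simp at hk'
      · rw [front_succ_of_ne hu (Ne.symm h1), hcells2]
        simp only [Finset.mem_insert, not_or]
        obtain ⟨r', hr'⟩ := front_eq_cell (l := l) u k
        exact ⟨by rw [hr', cellOf]; intro e; cases e; exact h1 rfl, by rw [hr']; simp, hI.empty k hk hk'⟩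
    · intro k hk c' hk'
      rw [hsl, List.getElem?_set]
      split_ifs with h1
      · exfalso; subst h1; rw [← cellOf_eq_front_succ hu, cellOf] at hk'; cases hk'
      · rw [front_succ_of_ne hu (Ne.symm h1)] at hk'; exact hI.dummy k hk c' hk'
    · rw [hcells2]; simp only [Finset.mem_insert]
      simp only [reduceCtorEq, cellOf, true_or, or_true, true_iff]
      exact (src_time_of_start hu hl0 hst).1
    · rw [hcells2, hsi]; simp only [Finset.mem_insert, cellOf, reduceCtorEq, false_or]; exact hI.vsnk_mem
    · intro p
      rw [hpairs2, Nat.exists_lt_succ_right, hcs, Finset.mem_insert]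
      simp only [Bool.false_eq_true, false_and, or_false]
      constructor
      · rintro ⟨rfl | hp, hreal⟩
        · exact absurd (Sym2.ball.1 hreal).2 (by simp [XCell.IsReal])
        · exact (hI.pairs_iff p).1 ⟨hp, hreal⟩
      · intro h; obtain ⟨hp, hreal⟩ := (hI.pairs_iff p).2 h; exact ⟨Or.inr hp, hreal⟩
    · intro k hk; rw [hga, hcount_succ_of_even hu]; exact hI.gaps_eq k hk
  · -- not the start cell: nothing happens to the family
    have hst' : isStart l r0 (u / 2) = false := by simpa using hst
    rw [if_neg hst]
    simp only [hst', Bool.false_eq_true, if_false] at hsl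
    refine ⟨?_, ?_, ?_, hI.wf, hI.two_le, ?_, ?_, ?_, ?_, ?_, ?_, ?_, ?_⟩
    · rw [hsl, List.length_set, hI.len_slots]
    · rw [hga, hI.len_gaps]
    · intro k j h
      rw [hsl, List.getElem?_set] at h
      split_ifs at h with h1
      · simp at h
      · exact hI.mate_lt k j h
    · intro x hx; exact (processed_succ_even hu hl0 _).2 (Or.inl (hI.processed x hx))
    · intro a b ha
      rw [hends_old a b ha, hsl]
      constructor
      · rintro ⟨k, hk, m, hkc, hkm, rfl, rfl⟩
        exact ⟨k, hk, m, by rw [List.getElem?_set_ne (Ne.symm hkc)]; exact hkm, rfl, rfl⟩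
      · rintro ⟨k, hk, m, hkm, rfl, rfl⟩
        rw [List.getElem?_set] at hkm
        split_ifs at hkm with h1
        · simp at hkm
        · exact ⟨k, hk, m, Ne.symm h1, hkm, rfl, rfl⟩
    · intro k hk hk'
      rw [hsl, List.getElem?_set] at hk'
      split_ifs at hk' with h1
      · subst h1; rw [← cellOf_eq_front_succ hu]; exact hvnot
      · rw [front_succ_of_ne hu (Ne.symm h1)]; exact hI.empty k hk hk'
    · intro k hk c' hk'
      rw [hsl, List.getElem?_set]
      split_ifs with h1
      · exfalso; subst h1; rw [← cellOf_eq_front_succ hu, cellOf] at hk'; cases hk'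
      · rw [front_succ_of_ne hu (Ne.symm h1)] at hk'; exact hI.dummy k hk c' hk'
    · rw [hI.vsrc_mem, src_time_succ_iff hu hl0 hst']
    · rw [hsi]; exact hI.vsnk_mem
    · intro p
      rw [Nat.exists_lt_succ_right, hcs, hI.pairs_iff]
      simp
    · intro k hk; rw [hga, hcount_succ_of_even hu]; exact hI.gaps_eq k hk

end Advance

end StripTM

end Literature.Probability.RandomPlanarGeometry.SAW
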